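import Literature.MeasureTheory.Group.DiscreteSubgroupDomain

/-!
# Fundamental domains for cocompact discrete subgroups WITHOUT second countability

Topic `MeasureTheory/Group`. `DiscreteFundamentalDomain` / `DiscreteSubgroupDomain` assume
`SecondCountableTopology G` (to extract a countable subcover). For the COCOMPACT case this is unnecessary:
the compact set `K` meeting every orbit has a finite subcover, and in general a LINDELÖF `K` suffices.
This file proves the Lindelöf form of the abstract theorem and the cocompact existence theorems under
`[DiscreteTopology Γ] [Countable Γ] [LocallyCompactSpace G] [CompactSpace (G ⧸ Γ)]` and the Borel
σ-algebra only:

* `exists_subset_measurableSet_existsUnique_of_isLindelof` — abstract theorem, `IsLindelof K`;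
* `exists_fundamentalDomain_op_relCompact'` / `_left_relCompact'`,
  `exists_isFundamentalDomain_op_finite'` / `_left_finite'`, `hasFundamentalDomain_op'` — no second
  countability;
* `exists_fundamentalDomain_left/op_of_lindelof` — plain existence for a Lindelöf (e.g. σ-compact) `G`
  (Margulis, *Discrete subgroups of semisimple Lie groups*, I.0.40; Bourbaki, *Intégration* VII §2 ex. 12).

Everything is proved (Mathlib + the two tree files only).

## Provenance

Reproduced for the tree under the LEAN-IN-TREE rule (2026-08-18) from the pub-hodgecm cell's package file
`HodgeCM/PerL34/CocompactFundamentalDomain.lean` (DAG-node prover #09 lineage, seat pv09-g4, gate run 25;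
180 lines), verbatim up to: the namespace (`HodgeCM.PerL34.DiscreteFD` ↦
`Literature.MeasureTheory.Group.DiscreteSubgroup`), the construction (`dom` ↦ the tree's
`strictFundamentalDomain` through the bridge lemmas of `DiscreteSubgroupDomain`), `countable_op'` a theorem
instead of an instance, added docstrings.
-/

set_option autoImplicit false

noncomputable section

open _root_.MeasureTheory Set Filter _root_.Topology
open scoped Pointwise

namespace Literature.MeasureTheory.Group.DiscreteSubgroup

/-! ## §1 The abstract theorem for a Lindelöf `K` -/

section Local

variable {Γ : Type*} {X : Type*} [Group Γ] [MulAction Γ X] [TopologicalSpace X]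

/-- A countable family of open sets, each moved off itself by every `γ ≠ 1`, covering a Lindelöf `K`. [folklore] -/
theorem exists_seq_of_isLindelof {K : Set X} (hKL : IsLindelof K)
    (hV : ∀ x ∈ K, ∃ V : Set X, IsOpen V ∧ x ∈ V ∧ ∀ γ : Γ, γ ≠ 1 → Disjoint (γ • V) V) :
    ∃ u : ℕ → Set X, (∀ n, IsOpen (u n)) ∧
      (∀ (n : ℕ) (γ : Γ), γ ≠ 1 → Disjoint (γ • u n) (u n)) ∧ K ⊆ ⋃ n, u n := by
  rcases K.eq_empty_or_nonempty with rfl | hK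
  · exact ⟨fun _ => ∅, fun _ => isOpen_empty, fun n γ _ => by simp, empty_subset _⟩
  have hV' : ∀ x : K, ∃ V : Set X, IsOpen V ∧ (x : X) ∈ V ∧
      ∀ γ : Γ, γ ≠ 1 → Disjoint (γ • V) V := fun x => hV x x.2
  choose V hVo hxV hVd using hV'
  obtain ⟨T, hTc, hTU⟩ := hKL.elim_countable_subcover V hVo
    (fun x hx => mem_iUnion.2 ⟨⟨x, hx⟩, hxV _⟩)
  haveI : Nonempty K := hK.to_subtype
  obtain ⟨f, hf⟩ := Set.countable_iff_exists_subset_range.1 hTc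
  refine ⟨fun n => V (f n), fun n => hVo _, fun n γ hγ => hVd _ γ hγ, fun x hx => ?_⟩
  obtain ⟨i, hi, hxi⟩ := mem_iUnion₂.1 (hTU hx)
  obtain ⟨n, rfl⟩ := hf hi
  exact mem_iUnion.2 ⟨n, hxi⟩

/-- **Abstract existence theorem, Lindelöf form.**  A countable group acting measurably, a measurable
LINDELÖF `K` meeting every orbit, local separation at the points of `K` ⇒ a measurable `𝓕 ⊆ K`
meeting every orbit in exactly one point. [folklore] -/
theorem exists_subset_measurableSet_existsUnique_of_isLindelof
    [MeasurableSpace X] [OpensMeasurableSpace X] [Countable Γ] [MeasurableConstSMul Γ X]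
    {K : Set X} (hKm : MeasurableSet K) (hKL : IsLindelof K) (hKcov : ∀ x : X, ∃ γ : Γ, γ • x ∈ K)
    (hV : ∀ x ∈ K, ∃ V : Set X, IsOpen V ∧ x ∈ V ∧ ∀ γ : Γ, γ ≠ 1 → Disjoint (γ • V) V) :
    ∃ 𝓕 : Set X, 𝓕 ⊆ K ∧ MeasurableSet 𝓕 ∧ ∀ x : X, ∃! γ : Γ, γ • x ∈ 𝓕 := by
  obtain ⟨u, huo, hud, hKu⟩ := exists_seq_of_isLindelof (Γ := Γ) hKL hV
  refine ⟨strictFundamentalDomain Γ (fun n => u n ∩ K),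
    strictFundamentalDomain_subset fun n => inter_subset_right,
    measurableSet_strictFundamentalDomain' fun n => (huo n).measurableSet.inter hKm,
    existsUnique_smul_mem_strictFundamentalDomain' (fun n γ hγ => ?_) (fun x => ?_)⟩
  · exact (hud n γ hγ).mono (smul_set_mono inter_subset_left) inter_subset_left
  · obtain ⟨γ, hγ⟩ := hKcov x
    obtain ⟨n, hn⟩ := mem_iUnion.1 (hKu hγ)
    exact ⟨γ, n, hn, hγ⟩

end Local

/-! ## §2 Discrete subgroups: Lindelöf groups and cocompact subgroups, no second countability -/

section Group

variable {G : Type*} [Group G] [TopologicalSpace G] [IsTopologicalGroup G] [MeasurableSpace G]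
  [BorelSpace G]

omit [TopologicalSpace G] [IsTopologicalGroup G] [MeasurableSpace G] [BorelSpace G] in
/-- The opposite of a countable subgroup is countable. [folklore] -/
theorem countable_op' (Γ : Subgroup G) [Countable Γ] : Countable Γ.op :=
  Countable.of_equiv _ Γ.equivOp

/-- Left action, inside a covering measurable Lindelöf `K`. [folklore] -/
theorem exists_fundamentalDomain_left_subset' (Γ : Subgroup G) [DiscreteTopology Γ] [Countable Γ]
    {K : Set G} (hKm : MeasurableSet K) (hKL : IsLindelof K)
    (hKcov : ∀ x : G, ∃ γ : Γ, γ • x ∈ K) :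
    ∃ 𝓕 : Set G, 𝓕 ⊆ K ∧ MeasurableSet 𝓕 ∧ ∀ x : G, ∃! γ : Γ, γ • x ∈ 𝓕 :=
  exists_subset_measurableSet_existsUnique_of_isLindelof hKm hKL hKcov
    fun x _ => exists_local_left Γ x

/-- Right action (`Γ.op`), inside a covering measurable Lindelöf `K`. [folklore] -/
theorem exists_fundamentalDomain_op_subset' (Γ : Subgroup G) [DiscreteTopology Γ] [Countable Γ]
    {K : Set G} (hKm : MeasurableSet K) (hKL : IsLindelof K)
    (hKcov : ∀ x : G, ∃ γ : Γ.op, γ • x ∈ K) :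
    ∃ 𝓕 : Set G, 𝓕 ⊆ K ∧ MeasurableSet 𝓕 ∧ ∀ x : G, ∃! γ : Γ.op, γ • x ∈ 𝓕 :=
  haveI := countable_op' Γ
  exists_subset_measurableSet_existsUnique_of_isLindelof hKm hKL hKcov
    fun x _ => exists_local_op Γ x

/-- **Existence for a Lindelöf group** (σ-compact suffices), left action. [folklore] -/
theorem exists_fundamentalDomain_left_of_lindelof [LindelofSpace G] (Γ : Subgroup G)
    [DiscreteTopology Γ] [Countable Γ] :
    ∃ 𝓕 : Set G, MeasurableSet 𝓕 ∧ ∀ x : G, ∃! γ : Γ, γ • x ∈ 𝓕 := by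
  obtain ⟨𝓕, -, h⟩ := exists_fundamentalDomain_left_subset' Γ MeasurableSet.univ isLindelof_univ
    (fun x => ⟨1, mem_univ _⟩)
  exact ⟨𝓕, h⟩

/-- **Existence for a Lindelöf group** (σ-compact suffices), right action. [folklore] -/
theorem exists_fundamentalDomain_op_of_lindelof [LindelofSpace G] (Γ : Subgroup G)
    [DiscreteTopology Γ] [Countable Γ] :
    ∃ 𝓕 : Set G, MeasurableSet 𝓕 ∧ ∀ x : G, ∃! γ : Γ.op, γ • x ∈ 𝓕 := by
  obtain ⟨𝓕, -, h⟩ := exists_fundamentalDomain_op_subset' Γ MeasurableSet.univ isLindelof_univ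
    (fun x => ⟨1, mem_univ _⟩)
  exact ⟨𝓕, h⟩

variable [LocallyCompactSpace G]

/-- **Cocompact case, right action, no second countability**: a relatively compact measurable
fundamental domain. [folklore] -/
theorem exists_fundamentalDomain_op_relCompact' (Γ : Subgroup G) [DiscreteTopology Γ] [Countable Γ]
    [CompactSpace (G ⧸ Γ)] :
    ∃ 𝓕 : Set G, MeasurableSet 𝓕 ∧ IsCompact (closure 𝓕) ∧
      ∀ x : G, ∃! γ : Γ.op, γ • x ∈ 𝓕 := by
  obtain ⟨K, hKc, hKcl, hK⟩ := exists_isCompact_cover_op Γ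
  obtain ⟨𝓕, h𝓕K, h𝓕m, h⟩ :=
    exists_fundamentalDomain_op_subset' Γ hKcl.measurableSet hKc.isLindelof hK
  exact ⟨𝓕, h𝓕m, hKc.of_isClosed_subset isClosed_closure (closure_minimal h𝓕K hKcl), h⟩

/-- **Cocompact case, left action, `Γ` normal, no second countability.** [folklore] -/
theorem exists_fundamentalDomain_left_relCompact' (Γ : Subgroup G) [DiscreteTopology Γ]
    [Countable Γ] [Γ.Normal] [CompactSpace (G ⧸ Γ)] :
    ∃ 𝓕 : Set G, MeasurableSet 𝓕 ∧ IsCompact (closure 𝓕) ∧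
      ∀ x : G, ∃! γ : Γ, γ • x ∈ 𝓕 := by
  obtain ⟨K, hKc, hKcl, hK⟩ := exists_isCompact_cover_left Γ
  obtain ⟨𝓕, h𝓕K, h𝓕m, h⟩ :=
    exists_fundamentalDomain_left_subset' Γ hKcl.measurableSet hKc.isLindelof hK
  exact ⟨𝓕, h𝓕m, hKc.of_isClosed_subset isClosed_closure (closure_minimal h𝓕K hKcl), h⟩

/-- Measure form, right action: for every measure finite on compact sets, a measurable fundamental
domain for `Γ.op` of finite measure, relatively compact. [folklore] -/
theorem exists_isFundamentalDomain_op_finite' (Γ : Subgroup G) [DiscreteTopology Γ] [Countable Γ]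
    [CompactSpace (G ⧸ Γ)] (μ : Measure G) [IsFiniteMeasureOnCompacts μ] :
    ∃ 𝓕 : Set G, MeasurableSet 𝓕 ∧ IsFundamentalDomain Γ.op 𝓕 μ ∧
      IsCompact (closure 𝓕) ∧ μ 𝓕 < ⊤ := by
  obtain ⟨𝓕, h𝓕m, hc, h⟩ := exists_fundamentalDomain_op_relCompact' Γ
  exact ⟨𝓕, h𝓕m, isFundamentalDomain_of_existsUnique h𝓕m h μ, hc,
    (measure_mono subset_closure).trans_lt hc.measure_lt_top⟩

/-- Measure form, left action, `Γ` normal. [folklore] -/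
theorem exists_isFundamentalDomain_left_finite' (Γ : Subgroup G) [DiscreteTopology Γ]
    [Countable Γ] [Γ.Normal] [CompactSpace (G ⧸ Γ)] (μ : Measure G)
    [IsFiniteMeasureOnCompacts μ] :
    ∃ 𝓕 : Set G, MeasurableSet 𝓕 ∧ IsFundamentalDomain Γ 𝓕 μ ∧
      IsCompact (closure 𝓕) ∧ μ 𝓕 < ⊤ := by
  obtain ⟨𝓕, h𝓕m, hc, h⟩ := exists_fundamentalDomain_left_relCompact' Γ
  exact ⟨𝓕, h𝓕m, isFundamentalDomain_of_existsUnique h𝓕m h μ, hc,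
    (measure_mono subset_closure).trans_lt hc.measure_lt_top⟩

/-- `HasFundamentalDomain` for the right action of a cocompact discrete countable subgroup. [folklore] -/
theorem hasFundamentalDomain_op' (Γ : Subgroup G) [DiscreteTopology Γ] [Countable Γ]
    [CompactSpace (G ⧸ Γ)] (μ : Measure G) : HasFundamentalDomain Γ.op G μ := by
  obtain ⟨𝓕, h𝓕m, -, h⟩ := exists_fundamentalDomain_op_relCompact' Γ
  exact ⟨⟨𝓕, isFundamentalDomain_of_existsUnique h𝓕m h μ⟩⟩

end Group

end Literature.MeasureTheory.Group.DiscreteSubgroup
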